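import Literature.Probability.LatticeModels.PairIdentities

/-!
# The Kirchhoff arrival functional of the cut orbit and its values in Smirnov's three cases
(helper for stub `stub_kirchhoff` of line `finitary-green-pairing`, crux `CoherentMorera`, stmt-CriticalPhenomena-11388)

Spin-free analogue of `PairIdentities.arrivalSum`: for a phase function `Φ : ℤ → ℂ` of the turn count
and a turn factor `g : ℤ → ℂ`, the functional
`kSum Φ g β₀ c₀ p N₀ = ∑_{j<N₀, orb j ∈ {p, partner p}} ε_j · Φ (C_j) · g (s_j)`, `ε_j = +1` at `p` and
`-1` at the partner, evaluated on the explorations of a configuration and of the configuration toggled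
at the edge `e = cTgt p`:

* `kSum_case0` — no arrival: both vanish;
* `kSum_case2_eval` — both corners arrive in `ω` (`p` first, crossing, turn counts `C` and `C - 2`), one
  arrival in `ω ∪ e` (following, turn count `C`);
* `kSum_case1_eval` — `p` arrives in `ω` (crossing, `C`), the partner never; in `ω ∪ e` the partner's
  loop is spliced in and `e` is followed twice (turn counts `C` and `C + 2`).

The turn-count shifts `∓2` are where the SIGNED Umlaufsatz enters: they are the hypotheses `hU`
(turning number `-4` of the excised cycle, `+4` of the spliced loop), discharged in the assembly file
from `cycleTurning_signed`.  Everything else is the bookkeeping of `arrivalSum_case1/2` verbatim.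
-/

noncomputable section

namespace Summit.CriticalPhenomena.CardyFormulaZ2.Cruxes.CoherentMorera.FinitaryGreenPairing

open Literature.Probability.LatticeModels
open Literature.Probability.Percolation (BondConfig)

open scoped Classical

/- The Kirchhoff arrival functional of the cut orbit of length `N₀` from `c₀` at the edge `e = cTgt p`
is written out in full in every statement (no definition, no notation):
`∑ j ∈ (range N₀).filter (orb j = p ∨ orb j = partner p), (if orb j = p then 1 else -1) * (Φ (C_j) * g (s_j))`. -/

/-- The functional is antisymmetric in the two arriving corners. -/
theorem kSum_partner (Φ g : ℤ → ℂ) (β₀ : BondConfig (Site 2)) (c₀ p₀ : Site 2 × Fin 4) (N₀ : ℕ) :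
    (∑ j ∈ (Finset.range N₀).filter (fun j => cornerOrbit β₀ c₀ j = (cornerPartner p₀) ∨ cornerOrbit β₀ c₀ j = cornerPartner (cornerPartner p₀)),
        (if cornerOrbit β₀ c₀ j = (cornerPartner p₀) then (1 : ℂ) else -1) * (Φ (turnCount β₀ c₀ j) * g (turnSign β₀ (cornerOrbit β₀ c₀ j)))) = -(∑ j ∈ (Finset.range N₀).filter (fun j => cornerOrbit β₀ c₀ j = p₀ ∨ cornerOrbit β₀ c₀ j = cornerPartner p₀),
        (if cornerOrbit β₀ c₀ j = p₀ then (1 : ℂ) else -1) * (Φ (turnCount β₀ c₀ j) * g (turnSign β₀ (cornerOrbit β₀ c₀ j)))) := by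
  rw [← Finset.sum_neg_distrib]
  refine Finset.sum_congr ?_ fun j hj => ?_
  · refine Finset.filter_congr fun j _ => ?_
    rw [partner_partner, or_comm]
  · rw [Finset.mem_filter] at hj
    rcases hj.2 with h | h
    · rw [if_neg (by rw [h]; exact (partner_ne p₀).symm), if_pos h]; ring
    · rw [if_pos h, if_neg (by rw [h]; exact partner_ne p₀)]; ring

section Pair

variable {D : DiscreteDobrushin} {ω ω' : BondConfig (Site 2)} {c₀ p : Site 2 × Fin 4}


/-- **Case 0**: no dart of the exploration of `ω` arrives at `e`; then neither does any dart of the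
exploration of the toggled configuration, and both functionals vanish. -/
theorem kSum_case0 (hagree : ∀ e, e ≠ cTgt p → (e ∈ (D.bcBondConfig ω') ↔ e ∈ (D.bcBondConfig ω))) (hdiff : ¬ (cTgt p ∈ (D.bcBondConfig ω') ↔ cTgt p ∈ (D.bcBondConfig ω))) {N : ℕ}
    (h₁ : ∀ i < N, cornerOrbit (D.bcBondConfig ω) c₀ i ≠ p) (h₂ : ∀ i < N, cornerOrbit (D.bcBondConfig ω) c₀ i ≠ cornerPartner p) (Φ g : ℤ → ℂ) :
    (∑ j ∈ (Finset.range N).filter (fun j => cornerOrbit (D.bcBondConfig ω) c₀ j = p ∨ cornerOrbit (D.bcBondConfig ω) c₀ j = cornerPartner p),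
        (if cornerOrbit (D.bcBondConfig ω) c₀ j = p then (1 : ℂ) else -1) * (Φ (turnCount (D.bcBondConfig ω) c₀ j) * g (turnSign (D.bcBondConfig ω) (cornerOrbit (D.bcBondConfig ω) c₀ j)))) = 0 ∧ (∑ j ∈ (Finset.range N).filter (fun j => cornerOrbit (D.bcBondConfig ω') c₀ j = p ∨ cornerOrbit (D.bcBondConfig ω') c₀ j = cornerPartner p),
        (if cornerOrbit (D.bcBondConfig ω') c₀ j = p then (1 : ℂ) else -1) * (Φ (turnCount (D.bcBondConfig ω') c₀ j) * g (turnSign (D.bcBondConfig ω') (cornerOrbit (D.bcBondConfig ω') c₀ j)))) = 0 := by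
  have hcase := cornerOrbit_toggle_case0 hagree hdiff h₁ h₂
  constructor
  · refine Finset.sum_eq_zero fun j hj => ?_
    rw [Finset.mem_filter, Finset.mem_range] at hj
    rcases hj.2 with h | h
    · exact absurd h (h₁ j hj.1)
    · exact absurd h (h₂ j hj.1)
  · refine Finset.sum_eq_zero fun j hj => ?_
    rw [Finset.mem_filter, Finset.mem_range] at hj
    rw [hcase j hj.1.le] at hj
    rcases hj.2 with h | h
    · exact absurd h (h₁ j hj.1)
    · exact absurd h (h₂ j hj.1)

/-- **Case 2, evaluated** (both corners arrive in `ω`, `p = cornerOrbit (D.bcBondConfig ω) c₀ i₁` before its partner `cornerOrbit (D.bcBondConfig ω) c₀ i₂`, `e`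
closed in `ω`).  With `C = turnCount (D.bcBondConfig ω) c₀ i₁`: the functional of `ω` is `Φ C · g 1 - Φ (C - 2) · g 1`
and that of `ω ∪ e` (whose exploration has the stretch `i₁+1 … i₂` excised and exits at `N - (i₂ - i₁)`)
is `Φ C · g (-1)`, PROVIDED the excised stretch — a cycle of the toggled rule of minimal period
`i₂ - i₁` through `cornerOrbit (D.bcBondConfig ω) c₀ (i₁ + 1)` — has turning number `-4` (hypothesis `hU`). -/
theorem kSum_case2_eval (hD : D.IsZdAdmissible) (hc₀ : D.IsStartCorner c₀)
    (hagree : ∀ e, e ≠ cTgt p → (e ∈ (D.bcBondConfig ω') ↔ e ∈ (D.bcBondConfig ω))) (hdiff : ¬ (cTgt p ∈ (D.bcBondConfig ω') ↔ cTgt p ∈ (D.bcBondConfig ω))) (he : cTgt p ∉ (D.bcBondConfig ω))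
    {N i₁ i₂ : ℕ} (hlt : ∀ k < N, D.IsInnerFace (cFace (cornerOrbit (D.bcBondConfig ω) c₀ k))) (hi₁ : cornerOrbit (D.bcBondConfig ω) c₀ i₁ = p) (hi₂ : cornerOrbit (D.bcBondConfig ω) c₀ i₂ = cornerPartner p)
    (h12 : i₁ < i₂) (hi₂N : i₂ < N)
    (hU : ∑ m ∈ Finset.range (i₂ - i₁), turnSign (D.bcBondConfig ω') (cornerOrbit (D.bcBondConfig ω') (cornerOrbit (D.bcBondConfig ω) c₀ (i₁ + 1)) m) = -4) (Φ g : ℤ → ℂ) :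
    (∑ j ∈ (Finset.range N).filter (fun j => cornerOrbit (D.bcBondConfig ω) c₀ j = p ∨ cornerOrbit (D.bcBondConfig ω) c₀ j = cornerPartner p),
        (if cornerOrbit (D.bcBondConfig ω) c₀ j = p then (1 : ℂ) else -1) * (Φ (turnCount (D.bcBondConfig ω) c₀ j) * g (turnSign (D.bcBondConfig ω) (cornerOrbit (D.bcBondConfig ω) c₀ j)))) = Φ (turnCount (D.bcBondConfig ω) c₀ i₁) * g 1 - Φ (turnCount (D.bcBondConfig ω) c₀ i₁ - 2) * g 1 ∧
      (∑ j ∈ (Finset.range (N - (i₂ - i₁))).filter (fun j => cornerOrbit (D.bcBondConfig ω') c₀ j = p ∨ cornerOrbit (D.bcBondConfig ω') c₀ j = cornerPartner p),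
        (if cornerOrbit (D.bcBondConfig ω') c₀ j = p then (1 : ℂ) else -1) * (Φ (turnCount (D.bcBondConfig ω') c₀ j) * g (turnSign (D.bcBondConfig ω') (cornerOrbit (D.bcBondConfig ω') c₀ j)))) = Φ (turnCount (D.bcBondConfig ω) c₀ i₁) * g (-1) := by
  classical
  have he' : cTgt p ∈ (D.bcBondConfig ω') := by
    by_contra h; exact hdiff ⟨fun h' => absurd h' h, fun h' => absurd h' he⟩
  have hinj : ∀ a b, a < N → b < N → cornerOrbit (D.bcBondConfig ω) c₀ a = cornerOrbit (D.bcBondConfig ω) c₀ b → a = b := by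
    intro a b ha hb h
    by_contra hne
    rcases Nat.lt_or_gt_of_ne hne with hab | hab
    · exact cornerOrbit_ne hD hc₀ hab (fun k hk => hlt k (by omega)) h
    · exact cornerOrbit_ne hD hc₀ hab (fun k hk => hlt k (by omega)) h.symm
  obtain ⟨hpre, htail⟩ := cornerOrbit_toggle_case2 hD hc₀ hagree hdiff hlt hi₁ hi₂ h12 hi₂N
  -- targets of darts strictly between or outside `{i₁, i₂}` are not `e`
  have htgt : ∀ j < N, j ≠ i₁ → j ≠ i₂ → cTgt (cornerOrbit (D.bcBondConfig ω) c₀ j) ≠ cTgt p := by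
    intro j hj h1 h2 h
    rcases cTgt_eq_cTgt_iff.1 h with h | h
    · exact h1 (hinj j i₁ hj (by omega) (h.trans hi₁.symm))
    · exact h2 (hinj j i₂ hj hi₂N (h.trans hi₂.symm))
  -- the arrivals of `ω`: exactly `i₁` and `i₂`
  have hfilt : (Finset.range N).filter (fun j => cornerOrbit (D.bcBondConfig ω) c₀ j = p ∨ cornerOrbit (D.bcBondConfig ω) c₀ j = cornerPartner p) = {i₁, i₂} := by
    ext j
    simp only [Finset.mem_filter, Finset.mem_range, Finset.mem_insert, Finset.mem_singleton]
    constructor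
    · rintro ⟨hj, h | h⟩
      · exact Or.inl (hinj j i₁ hj (by omega) (h.trans hi₁.symm))
      · exact Or.inr (hinj j i₂ hj hi₂N (h.trans hi₂.symm))
    · rintro (rfl | rfl)
      · exact ⟨by omega, Or.inl hi₁⟩
      · exact ⟨hi₂N, Or.inr hi₂⟩
  -- the arrivals of `ω ∪ e`: exactly `i₁`
  have hfilt' : (Finset.range (N - (i₂ - i₁))).filter (fun j => cornerOrbit (D.bcBondConfig ω') c₀ j = p ∨ cornerOrbit (D.bcBondConfig ω') c₀ j = cornerPartner p) = {i₁} := by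
    ext j
    simp only [Finset.mem_filter, Finset.mem_range, Finset.mem_singleton]
    constructor
    · rintro ⟨hj, h⟩
      by_cases hji : j ≤ i₁
      · rw [hpre j hji] at h
        rcases h with h | h
        · exact hinj j i₁ (by omega) (by omega) (h.trans hi₁.symm)
        · have := hinj j i₂ (by omega) hi₂N (h.trans hi₂.symm); omega
      · exfalso
        have ht := htail (j - i₁ - 1) (by omega)
        rw [show i₁ + 1 + (j - i₁ - 1) = j by omega] at ht
        rw [ht] at h
        have hidx : i₂ + 1 + (j - i₁ - 1) < N := by omega
        rcases h with h | h
        · have := hinj _ i₁ hidx (by omega) (h.trans hi₁.symm); omega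
        · have := hinj _ i₂ hidx hi₂N (h.trans hi₂.symm); omega
    · rintro rfl
      exact ⟨by omega, Or.inl (by rw [hpre j le_rfl, hi₁])⟩
  -- turn counts: same prefix
  have hC : turnCount (D.bcBondConfig ω') c₀ i₁ = turnCount (D.bcBondConfig ω) c₀ i₁ :=
    turnCount_congr_prefix hpre fun j hj => hagree _ (htgt j (by omega) (by omega) (by omega))
  -- the excised loop is a cycle of the toggled rule from `cornerOrbit (D.bcBondConfig ω) c₀ (i₁+1)`
  have hcyc : ∀ m, m + 1 ≤ i₂ - i₁ → cornerOrbit (D.bcBondConfig ω') (cornerOrbit (D.bcBondConfig ω) c₀ (i₁ + 1)) m = cornerOrbit (D.bcBondConfig ω) c₀ (i₁ + 1 + m) := by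
    intro m hm
    induction m with
    | zero => rfl
    | succ m ih =>
      change nextCorner (D.bcBondConfig ω') (cornerOrbit (D.bcBondConfig ω') (cornerOrbit (D.bcBondConfig ω) c₀ (i₁ + 1)) m) = _
      rw [ih (by omega), show i₁ + 1 + (m + 1) = (i₁ + 1 + m) + 1 by omega, cornerOrbit_succ]
      refine nextCorner_toggle_of_ne hagree hdiff (fun h => ?_) (fun h => ?_)
      · have := hinj _ i₁ (by omega) (by omega) (h.trans hi₁.symm); omega
      · have := hinj _ i₂ (by omega) hi₂N (h.trans hi₂.symm); omega
  set M := i₂ - i₁ with hM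
  have hsum : ∑ m ∈ Finset.range M, turnSign (D.bcBondConfig ω') (cornerOrbit (D.bcBondConfig ω') (cornerOrbit (D.bcBondConfig ω) c₀ (i₁ + 1)) m) =
      (∑ m ∈ Finset.range (M - 1), turnSign (D.bcBondConfig ω) (cornerOrbit (D.bcBondConfig ω) c₀ (i₁ + 1 + m))) + (-1) := by
    rw [show M = (M - 1) + 1 by omega, Finset.sum_range_succ, Nat.add_sub_cancel]
    congr 1
    · refine Finset.sum_congr rfl fun m hm => ?_
      rw [Finset.mem_range] at hm
      rw [hcyc m (by omega)]
      exact turnSign_congr (hagree _ (htgt _ (by omega) (by omega) (by omega)))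
    · rw [hcyc (M - 1) (by omega), show i₁ + 1 + (M - 1) = i₂ by omega, hi₂]
      exact turnSign_of_mem (by rwa [cTgt_partner])
  rw [hsum] at hU
  -- the turn count at the second arrival
  have hC₂ : turnCount (D.bcBondConfig ω) c₀ i₂ = turnCount (D.bcBondConfig ω) c₀ i₁ - 2 := by
    have h' : turnCount (D.bcBondConfig ω) c₀ i₂ = turnCount (D.bcBondConfig ω) c₀ i₁ + 1 + ∑ m ∈ Finset.range (M - 1), turnSign (D.bcBondConfig ω) (cornerOrbit (D.bcBondConfig ω) c₀ (i₁ + 1 + m)) := by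
      rw [show i₂ = i₁ + M by omega, turnCount_add, show M = (M - 1) + 1 by omega, Finset.sum_range_succ', add_zero, hi₁,
        turnSign_of_not_mem he, Nat.add_sub_cancel]
      have : ∀ m, i₁ + (m + 1) = i₁ + 1 + m := fun m => by omega
      rw [Finset.sum_congr rfl (fun m _ => by rw [this m])]
      ring
    rw [h']; omega
  -- assemble
  have hp2 : cornerPartner p ≠ p := partner_ne p
  refine ⟨?_, ?_⟩
  · rw [hfilt, Finset.sum_pair (by omega : i₁ ≠ i₂), hi₁, hi₂, if_pos rfl, if_neg hp2,
      turnSign_of_not_mem he, turnSign_of_not_mem (show cTgt (cornerPartner p) ∉ (D.bcBondConfig ω) by rwa [cTgt_partner]), hC₂]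
    ring
  · rw [hfilt', Finset.sum_singleton, hpre i₁ le_rfl, hi₁, if_pos rfl, turnSign_of_mem he', hC]
    ring

/-- **Case 1, evaluated** (`p = cornerOrbit (D.bcBondConfig ω) c₀ i₁` arrives in `ω` at the closed interior edge `e`, its partner
never does).  With `C = turnCount (D.bcBondConfig ω) c₀ i₁`: the functional of `ω` is `Φ C · g 1`, and that of `ω ∪ e`
(whose exploration has the partner's loop `L` spliced in, exits at `N + Q`, and follows `e` at times `i₁`
and `i₁ + Q`) is `Φ C · g (-1) - Φ (C + 2) · g (-1)`, PROVIDED the loop `L` (minimal period `Q` through the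
partner, a cycle of the ORIGINAL rule) has turning number `+4` (hypothesis `hU`). -/
theorem kSum_case1_eval (hD : D.IsZdAdmissible) (hc₀ : D.IsStartCorner c₀)
    (hagree : ∀ e, e ≠ cTgt p → (e ∈ (D.bcBondConfig ω') ↔ e ∈ (D.bcBondConfig ω))) (hdiff : ¬ (cTgt p ∈ (D.bcBondConfig ω') ↔ cTgt p ∈ (D.bcBondConfig ω))) (he : cTgt p ∉ (D.bcBondConfig ω))
    (hx : ∀ j, D.IsInnerFace (faceAt p.1 j)) (hy : ∀ j, D.IsInnerFace (faceAt (p.1 + cornerUnit (p.2 + 1)) j))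
    {N P Q i₁ : ℕ} (hN : ¬ D.IsInnerFace (cFace (cornerOrbit (D.bcBondConfig ω) c₀ N))) (hlt : ∀ k < N, D.IsInnerFace (cFace (cornerOrbit (D.bcBondConfig ω) c₀ k)))
    (hP0 : 0 < P) (hP : cornerOrbit (D.bcBondConfig ω) c₀ P = c₀) (hPmin : ∀ s, 0 < s → s < P → cornerOrbit (D.bcBondConfig ω) c₀ s ≠ c₀)
    (hQ0 : 0 < Q) (hQ : cornerOrbit (D.bcBondConfig ω) (cornerPartner p) Q = cornerPartner p)
    (hQmin : ∀ s, 0 < s → s < Q → cornerOrbit (D.bcBondConfig ω) (cornerPartner p) s ≠ cornerPartner p)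
    (hi₁ : cornerOrbit (D.bcBondConfig ω) c₀ i₁ = p) (hi₁N : i₁ < N) (h₂ : ∀ i < N, cornerOrbit (D.bcBondConfig ω) c₀ i ≠ cornerPartner p)
    (hU : ∑ m ∈ Finset.range Q, turnSign (D.bcBondConfig ω) (cornerOrbit (D.bcBondConfig ω) (cornerPartner p) m) = 4) (Φ g : ℤ → ℂ) :
    (∑ j ∈ (Finset.range N).filter (fun j => cornerOrbit (D.bcBondConfig ω) c₀ j = p ∨ cornerOrbit (D.bcBondConfig ω) c₀ j = cornerPartner p),
        (if cornerOrbit (D.bcBondConfig ω) c₀ j = p then (1 : ℂ) else -1) * (Φ (turnCount (D.bcBondConfig ω) c₀ j) * g (turnSign (D.bcBondConfig ω) (cornerOrbit (D.bcBondConfig ω) c₀ j)))) = Φ (turnCount (D.bcBondConfig ω) c₀ i₁) * g 1 ∧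
      (∑ j ∈ (Finset.range (N + Q)).filter (fun j => cornerOrbit (D.bcBondConfig ω') c₀ j = p ∨ cornerOrbit (D.bcBondConfig ω') c₀ j = cornerPartner p),
        (if cornerOrbit (D.bcBondConfig ω') c₀ j = p then (1 : ℂ) else -1) * (Φ (turnCount (D.bcBondConfig ω') c₀ j) * g (turnSign (D.bcBondConfig ω') (cornerOrbit (D.bcBondConfig ω') c₀ j)))) = Φ (turnCount (D.bcBondConfig ω) c₀ i₁) * g (-1) - Φ (turnCount (D.bcBondConfig ω) c₀ i₁ + 2) * g (-1) := by
  classical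
  set p₂ := cornerPartner p with hp₂
  have he' : cTgt p ∈ (D.bcBondConfig ω') := by
    by_contra h; exact hdiff ⟨fun h' => absurd h' h, fun h' => absurd h' he⟩
  have hinj : ∀ a b, a < N → b < N → cornerOrbit (D.bcBondConfig ω) c₀ a = cornerOrbit (D.bcBondConfig ω) c₀ b → a = b := by
    intro a b ha hb h
    by_contra hne
    rcases Nat.lt_or_gt_of_ne hne with hab | hab
    · exact cornerOrbit_ne hD hc₀ hab (fun k hk => hlt k (by omega)) h
    · exact cornerOrbit_ne hD hc₀ hab (fun k hk => hlt k (by omega)) h.symm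
  -- the loop never meets the interface cycle
  have hdisj : ∀ m s, cornerOrbit (D.bcBondConfig ω) p₂ m ≠ cornerOrbit (D.bcBondConfig ω) c₀ s := by
    intro m s h
    obtain ⟨s', hs'⟩ := exists_eq_cornerOrbit_of_iterate hP0 hP m h
    have hin : D.IsInnerFace (cFace (cornerOrbit (D.bcBondConfig ω) c₀ s')) := hs' ▸ hy _
    rw [isInnerFace_cornerOrbit_iff hD hc₀ hN hlt hP0 hP hPmin] at hin
    exact h₂ _ hin (by rw [cornerOrbit_mod_period hP]; exact hs'.symm)
  obtain ⟨hpre, hloop, htail, -, -⟩ := cornerOrbit_toggle_case1 hD hc₀ hagree hdiff hx hy hN hlt hP0 hP hPmin hQ0 hQ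
    hQmin hi₁ hi₁N h₂
  -- the arrivals of `ω`: exactly `i₁`
  have hfilt : (Finset.range N).filter (fun j => cornerOrbit (D.bcBondConfig ω) c₀ j = p ∨ cornerOrbit (D.bcBondConfig ω) c₀ j = p₂) = {i₁} := by
    ext j
    simp only [Finset.mem_filter, Finset.mem_range, Finset.mem_singleton]
    constructor
    · rintro ⟨hj, h | h⟩
      · exact hinj j i₁ hj hi₁N (h.trans hi₁.symm)
      · exact absurd h (h₂ j hj)
    · rintro rfl; exact ⟨hi₁N, Or.inl hi₁⟩
  -- the arrivals of `ω ∪ e`: `i₁` and `i₁ + Q`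
  have hloopQ : cornerOrbit (D.bcBondConfig ω') c₀ (i₁ + Q) = p₂ := by
    have := hloop (Q - 1) (by omega)
    rwa [show i₁ + 1 + (Q - 1) = i₁ + Q by omega, Nat.sub_add_cancel hQ0, hQ] at this
  have hfilt' : (Finset.range (N + Q)).filter (fun j => cornerOrbit (D.bcBondConfig ω') c₀ j = p ∨ cornerOrbit (D.bcBondConfig ω') c₀ j = p₂) = {i₁, i₁ + Q} := by
    ext j
    simp only [Finset.mem_filter, Finset.mem_range, Finset.mem_insert, Finset.mem_singleton]
    constructor
    · rintro ⟨hj, h⟩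
      by_cases hj1 : j ≤ i₁
      · rw [hpre j hj1] at h
        rcases h with h | h
        · exact Or.inl (hinj j i₁ (by omega) hi₁N (h.trans hi₁.symm))
        · exact absurd h (h₂ j (by omega))
      · by_cases hj2 : j ≤ i₁ + Q
        · right
          have hl := hloop (j - i₁ - 1) (by omega)
          rw [show i₁ + 1 + (j - i₁ - 1) = j by omega] at hl
          rw [hl] at h
          rcases h with h | h
          · exact absurd (h.trans hi₁.symm) (hdisj _ _)
          · by_contra hne
            exact hQmin (j - i₁ - 1 + 1) (Nat.succ_pos _) (by omega) h
        · exfalso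
          have ht := htail (j - i₁ - Q - 1) (by omega)
          rw [show i₁ + Q + 1 + (j - i₁ - Q - 1) = j by omega] at ht
          rw [ht] at h
          have hidx : i₁ + 1 + (j - i₁ - Q - 1) < N := by omega
          rcases h with h | h
          · have := hinj _ i₁ hidx hi₁N (h.trans hi₁.symm); omega
          · exact h₂ _ hidx h
    · rintro (rfl | rfl)
      · exact ⟨by omega, Or.inl (by rw [hpre j le_rfl, hi₁])⟩
      · exact ⟨by omega, Or.inr hloopQ⟩
  -- targets before `i₁` are not `e`; same prefix turn count
  have htgt : ∀ j < N, j ≠ i₁ → cTgt (cornerOrbit (D.bcBondConfig ω) c₀ j) ≠ cTgt p := by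
    intro j hj h1 h
    rcases cTgt_eq_cTgt_iff.1 h with h | h
    · exact h1 (hinj j i₁ hj hi₁N (h.trans hi₁.symm))
    · exact h₂ j hj h
  have hC : turnCount (D.bcBondConfig ω') c₀ i₁ = turnCount (D.bcBondConfig ω) c₀ i₁ :=
    turnCount_congr_prefix hpre fun j hj => hagree _ (htgt j (by omega) (by omega))
  -- the loop corners' targets are not `e` (except at `p₂` itself)
  have hLtgt : ∀ m, 0 < m → m < Q → cTgt (cornerOrbit (D.bcBondConfig ω) p₂ m) ≠ cTgt p := by
    intro m hm hmQ h
    rcases cTgt_eq_cTgt_iff.1 h with h | h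
    · exact hdisj m i₁ (h.trans hi₁.symm)
    · exact hQmin m hm hmQ h
  -- the signed Umlaufsatz for `L` (in `(D.bcBondConfig ω)`): the turns after the first sum to `4 - 1`
  rw [show Q = (Q - 1) + 1 by omega, Finset.sum_range_succ'] at hU
  have hs0 : turnSign (D.bcBondConfig ω) (cornerOrbit (D.bcBondConfig ω) p₂ 0) = 1 := turnSign_of_not_mem (by
    change cTgt p₂ ∉ (D.bcBondConfig ω); rwa [hp₂, cTgt_partner])
  rw [hs0] at hU
  -- the turn count at the second arrival of `ω ∪ e`
  have hC₂ : turnCount (D.bcBondConfig ω') c₀ (i₁ + Q) = turnCount (D.bcBondConfig ω) c₀ i₁ + 2 := by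
    have h' : turnCount (D.bcBondConfig ω') c₀ (i₁ + Q) = turnCount (D.bcBondConfig ω) c₀ i₁ - 1 +
        ∑ m ∈ Finset.range (Q - 1), turnSign (D.bcBondConfig ω) (cornerOrbit (D.bcBondConfig ω) p₂ (m + 1)) := by
      rw [turnCount_add, show Q = (Q - 1) + 1 by omega, Finset.sum_range_succ', Nat.sub_add_cancel hQ0, add_zero, hpre i₁ le_rfl,
        hi₁, turnSign_of_mem he', hC]
      have hterm : ∀ m ∈ Finset.range (Q - 1), turnSign (D.bcBondConfig ω') (cornerOrbit (D.bcBondConfig ω') c₀ (i₁ + (m + 1))) = turnSign (D.bcBondConfig ω) (cornerOrbit (D.bcBondConfig ω) p₂ (m + 1)) := by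
        intro m hm
        rw [Finset.mem_range] at hm
        rw [show i₁ + (m + 1) = i₁ + 1 + m by omega, hloop m (by omega)]
        exact turnSign_congr (hagree _ (hLtgt (m + 1) (Nat.succ_pos _) (by omega)))
      rw [Finset.sum_congr rfl hterm]
      ring
    rw [h']; omega
  -- assemble
  have hp2 : p₂ ≠ p := partner_ne p
  refine ⟨?_, ?_⟩
  · rw [hfilt, Finset.sum_singleton, hi₁, if_pos rfl, turnSign_of_not_mem he]
    ring
  · rw [hfilt', Finset.sum_pair (by omega : i₁ ≠ i₁ + Q), hpre i₁ le_rfl, hi₁, hloopQ, if_pos rfl, if_neg hp2,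
      turnSign_of_mem he', turnSign_of_mem (show cTgt p₂ ∈ (D.bcBondConfig ω') by rwa [hp₂, cTgt_partner]), hC, hC₂]
    ring

end Pair

/-- **Case 0, registered form** (glue sub-goal `kirchhoffPairSums_case0` of the line): the Kirchhoff
functional of the toggled configuration vanishes when no dart of the original exploration arrives at `e`. -/
theorem kirchhoffPairSums_case0 : ∀ (D : DiscreteDobrushin) (ω ω' : BondConfig (Site 2)) (c₀ p : Site 2 × Fin 4) (N : ℕ) (Φ g : ℤ → ℂ), (∀ e, e ≠ cTgt p → (e ∈ D.bcBondConfig ω' ↔ e ∈ D.bcBondConfig ω)) → ¬ (cTgt p ∈ D.bcBondConfig ω' ↔ cTgt p ∈ D.bcBondConfig ω) → (∀ i < N, cornerOrbit (D.bcBondConfig ω) c₀ i ≠ p) → (∀ i < N, cornerOrbit (D.bcBondConfig ω) c₀ i ≠ cornerPartner p) → (∑ j ∈ (Finset.range N).filter (fun j => cornerOrbit (D.bcBondConfig ω') c₀ j = p ∨ cornerOrbit (D.bcBondConfig ω') c₀ j = cornerPartner p), (if cornerOrbit (D.bcBondConfig ω') c₀ j = p then (1 : ℂ) else -1) * (Φ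 (turnCount (D.bcBondConfig ω') c₀ j) * g (turnSign (D.bcBondConfig ω') (cornerOrbit (D.bcBondConfig ω') c₀ j)))) = 0 :=
  fun _ _ _ _ _ _ Φ g hagree hdiff h₁ h₂ => (kSum_case0 hagree hdiff h₁ h₂ Φ g).2

end Summit.CriticalPhenomena.CardyFormulaZ2.Cruxes.CoherentMorera.FinitaryGreenPairing

end
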